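import Summits.AtomisticToContinuum.Crystallization.Theorems.ExcessDecayLiouvilleNonlinearCaccioppoliStep
import Summits.AtomisticToContinuum.Crystallization.Theorems.ExcessDecayLiouvilleGiaquintaPow

/-!
# Route `ExcessDecayLiouville`: the nonlinear interior gradient bound (nonlinear Caccioppoli, IV)

Harmonic-replacement architecture for item `ExcessDecay` (stmt-AtomisticToContinuum-9334), nonlinear half.
The step `caccioppoli_step` (`Z(s) ≤ θ' Z(t) + A₂/(t−s)² + A₅/(t−s)⁵ + B₀` for gaps `≥ 120`,
`Z(ρ) = NN[f, c₀, ρ]`) is iterated by `giaquinta_iteration_pow` (exponent `5`, absorption factor `2⁻⁶`, which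
`θ' = 2(4·10⁶Λ)²/κ² ≤ 1/72` meets once `4·10⁶ Λ ≤ κ/12`); gaps `< 120` are covered trivially by
`Z ≤ Z(b) ≤ 120⁵ Z(b)/(t−s)⁵`.  Result (`gradient_mass_le`): for `a₀ ≤ a < b`,

`NN[f, c₀, a] ≤ 64 (A₂ (b−a)³ + A₅ + 120⁵ NN[f, c₀, b])/(b−a)⁵ + 2 B₀`,

i.e. the nearest-neighbour gradient mass of `f` on `B_a` is controlled by `κ⁻¹ (b−a)⁻² 𝐌[f, 2b]` plus
decaying and floor terms — the input that makes the Dirichlet correction small at every scale.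
All `[folklore]`; helper lemmas, nothing here closes an item.
-/

noncomputable section

namespace Summit.AtomisticToContinuum.Crystallization.Theorems.ExcessDecayLiouville

open scoped BigOperators Topology InnerProductSpace RealInnerProductSpace Classical
open Literature.MathematicalPhysics.StatisticalMechanics
open Summit.AtomisticToContinuum.Crystallization.Theorems.PhononStabilityNegative

-- Local notation: the force-constant map `K(e)w = h(|e|²)w + 2⟪e,w⟫h′(|e|²)e`.
local notation3 "𝕂[" e "] " w:max =>
  (-((‖e‖ ^ 2)⁻¹) ^ 7 + ((‖e‖ ^ 2)⁻¹) ^ 4) • w + (2 * ⟪e, w⟫ * (7 * ((‖e‖ ^ 2)⁻¹) ^ 8 - 4 * ((‖e‖ ^ 2)⁻¹) ^ 5)) • e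
set_option quotPrecheck false in
-- Local notation: ball indicator.
local notation "𝟙ᵇ[" x ", " c ", " R "]" => (if dist (x : EuclideanSpace ℝ (Fin 3)) c ≤ R then (1 : ℝ) else 0)

section

variable {t : Fin 2 → (EuclideanSpace ℝ (Fin 3))} {A : (EuclideanSpace ℝ (Fin 3)) →L[ℝ] (EuclideanSpace ℝ (Fin 3))}
  {κ : ℝ} {c₀ : EuclideanSpace ℝ (Fin 3)}

variable (hA : Adm₀ A) (hI : Inner₀ t A)

set_option quotPrecheck false in
-- Local notation: the operator row `(L v)(p)`.
local notation "𝕃" v:max " @ " p:max =>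
  tsum (fun q : Sites₀ t A => (if ((p : Sites₀ t A) : EuclideanSpace ℝ (Fin 3)) ≠ q then
    𝕂[((p : Sites₀ t A) : EuclideanSpace ℝ (Fin 3)) - q] (v ((p : Sites₀ t A) : EuclideanSpace ℝ (Fin 3)) - v q) else 0))
set_option quotPrecheck false in
-- Local notation: the finite near-neighbour form on the ball of radius `X` about `c₀`.
local notation "NN[" v ", " X "]" =>
  (∑ p ∈ (finite_sites_dist_le (t := t) (A := A) hA hI c₀ X).toFinset,
    ∑ q ∈ (finite_sites_dist_le (t := t) (A := A) hA hI c₀ X).toFinset,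
      (if p ≠ q ∧ dist p q ≤ 11 / 10 then ‖v p - v q‖ ^ 2 else (0 : ℝ)))
set_option quotPrecheck false in
-- local mass on the ball of radius `X` about `c₀`
local notation "𝐌[" f ", " X "]" =>
  tsum (fun p : Sites₀ t A => ‖f (p : EuclideanSpace ℝ (Fin 3))‖ ^ 2 * 𝟙ᵇ[p, c₀, X])
set_option quotPrecheck false in
-- weighted far mass with floor `Y` about `c₀`
local notation "𝐉[" f ", " Y "]" =>
  tsum (fun q : Sites₀ t A => ‖f (q : EuclideanSpace ℝ (Fin 3))‖ ^ 2 * (max (dist (q : EuclideanSpace ℝ (Fin 3)) c₀) Y)⁻¹ ^ 8)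

/-! ## Scalar steps -/

omit hA hI in
/-- Large gaps: the step inequality in Giaquinta form. [folklore] -/
theorem iter_scalar_large {Zs Zt Zb θ' B₀ A₂' A₅ ts ba : ℝ} (hstep : Zs ≤ θ' * Zt + B₀ + A₂' / ts ^ 2 + A₅ / ts ^ 5)
    (hθ : θ' ≤ 1 / 64) (hZt : 0 ≤ Zt) (hZb : 0 ≤ Zb) (hA₂ : 0 ≤ A₂') (hts : 120 ≤ ts) (htsba : ts ≤ ba) :
    Zs ≤ (1 / 2) ^ (5 + 1) * Zt + (A₂' * ba ^ 3 + A₅ + 120 ^ 5 * Zb) / ts ^ 5 + B₀ := by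
  have hts0 : 0 < ts := by linarith
  have h1 : θ' * Zt ≤ (1 / 2) ^ (5 + 1) * Zt := by
    have := mul_le_mul_of_nonneg_right hθ hZt; norm_num at this ⊢; linarith
  have h2 : A₂' / ts ^ 2 ≤ A₂' * ba ^ 3 / ts ^ 5 := by
    rw [div_le_div_iff₀ (by positivity) (by positivity)]
    have h3 : ts ^ 3 ≤ ba ^ 3 := pow_le_pow_left₀ hts0.le htsba 3
    have h4 : A₂' * ts ^ 5 = A₂' * ts ^ 3 * ts ^ 2 := by ring
    rw [h4]
    have := mul_le_mul_of_nonneg_left h3 hA₂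
    nlinarith [this, pow_nonneg hts0.le 2]
  have h3 : 0 ≤ 120 ^ 5 * Zb / ts ^ 5 := by positivity
  have e : (A₂' * ba ^ 3 + A₅ + 120 ^ 5 * Zb) / ts ^ 5 = A₂' * ba ^ 3 / ts ^ 5 + A₅ / ts ^ 5 + 120 ^ 5 * Zb / ts ^ 5 := by
    field_simp
  rw [e]
  linarith

omit hA hI in
/-- Small gaps: the trivial bound `Z ≤ Z(b) ≤ 120⁵ Z(b)/(t−s)⁵`. [folklore] -/
theorem iter_scalar_small {Zs Zt Zb B₀ A₂' A₅ ts ba : ℝ} (hZs : Zs ≤ Zb) (hZt : 0 ≤ Zt) (hZb : 0 ≤ Zb)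
    (hA₂ : 0 ≤ A₂') (hA₅ : 0 ≤ A₅) (hB₀ : 0 ≤ B₀) (hba : 0 ≤ ba) (hts0 : 0 < ts) (hts : ts < 120) :
    Zs ≤ (1 / 2) ^ (5 + 1) * Zt + (A₂' * ba ^ 3 + A₅ + 120 ^ 5 * Zb) / ts ^ 5 + B₀ := by
  have h1 : Zb ≤ 120 ^ 5 * Zb / ts ^ 5 := by
    rw [le_div_iff₀ (by positivity)]
    have h2 : ts ^ 5 ≤ 120 ^ 5 := pow_le_pow_left₀ hts0.le hts.le 5
    nlinarith
  have h3 : 0 ≤ (A₂' * ba ^ 3 + A₅) / ts ^ 5 := by positivity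
  have e : (A₂' * ba ^ 3 + A₅ + 120 ^ 5 * Zb) / ts ^ 5 = (A₂' * ba ^ 3 + A₅) / ts ^ 5 + 120 ^ 5 * Zb / ts ^ 5 := by
    field_simp
  rw [e]
  have h4 : 0 ≤ (1 / 2 : ℝ) ^ (5 + 1) * Zt := by positivity
  linarith

/-! ## The iterated bound -/

include hA hI in
/-- **The nonlinear interior gradient bound** (see the module docstring). [folklore] -/
theorem gradient_mass_le (hκ0 : 0 < κ)
    (hκ : ∀ v : (EuclideanSpace ℝ (Fin 3)) → (EuclideanSpace ℝ (Fin 3)), (Function.support v).Finite →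
      Function.support v ⊆ Sites₀ t A → κ * nnForm t A v ≤ ∑' p : Sites₀ t A, ⟪𝕃 v @ p, v p⟫)
    {f : (EuclideanSpace ℝ (Fin 3)) → (EuclideanSpace ℝ (Fin 3))} (hf : (Function.support f).Finite)
    {Bf : ℝ} (hfB : ∀ x, ‖f x‖ ≤ Bf) {a₀ a b : ℝ} (ha₀ : 0 < a₀) (ha₀a : a₀ ≤ a) (hab : a < b)
    (SR : Finset (EuclideanSpace ℝ (Fin 3))) (hSRS : ∀ x ∈ SR, x ∈ Sites₀ t A)
    (hSRball : ∀ x ∈ Sites₀ t A, dist x c₀ ≤ b → x ∈ SR)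
    (φ : (EuclideanSpace ℝ (Fin 3)) → (EuclideanSpace ℝ (Fin 3)))
    (Φ : (EuclideanSpace ℝ (Fin 3)) → (EuclideanSpace ℝ (Fin 3)) → (EuclideanSpace ℝ (Fin 3)))
    (hrow : ∀ p : Sites₀ t A, (p : EuclideanSpace ℝ (Fin 3)) ∈ SR → dist (p : EuclideanSpace ℝ (Fin 3)) c₀ ≤ b →
      𝕃 f @ p = φ p + ∑ q ∈ SR.erase p, Φ p q)
    (hanti : ∀ p ∈ SR, ∀ q ∈ SR, Φ q p = -Φ p q)
    {vt : (EuclideanSpace ℝ (Fin 3)) → (EuclideanSpace ℝ (Fin 3))} {Λ Θ₀ Θ₁ : ℝ} (hΛ : 0 ≤ Λ) (hΘ₀ : 0 ≤ Θ₀) (hΘ₁ : 0 ≤ Θ₁)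
    (hΛκ : 4000000 * Λ ≤ κ / 12)
    (hΦ : ∀ p ∈ SR, ∀ q ∈ SR, p ≠ q → ‖Φ p q‖ ≤ Λ * (dist p q)⁻¹ ^ 8 * ‖vt p - vt q‖)
    (hvt : ∀ x ∈ Sites₀ t A, dist x c₀ ≤ b → vt x = f x)
    (hΘ2 : ∀ R L : ℝ, R ≤ b → 1 ≤ L → ∑ p ∈ SR.filter (fun p => dist p c₀ ≤ R),
      ∑ q ∈ (SR.erase p).filter (fun q => ¬ dist p q ≤ L), (dist p q)⁻¹ ^ 8 * ‖vt q‖ ^ 2 ≤ Θ₀ / L ^ 5 + Θ₁) :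
    NN[f, a] ≤ 2 ^ (5 + 1) *
        (((2 / κ * (19 * 16 * (1024 / ((23 / 25 : ℝ) ^ 3 * (23 / 25 : ℝ) ^ 3))) +
            16 * (11 / 10 : ℝ) ^ 8 * (1024 / ((23 / 25 : ℝ) ^ 3 * (23 / 25 : ℝ) ^ 3))) * 𝐌[f, 2 * b] * (b - a) ^ 3 +
          2 / κ * (38 * 4 ^ 5 * (1024 / (23 / 25 : ℝ) ^ 3) * 𝐌[f, 2 * b] +
            Λ * 20 ^ 5 * ((7 / 2) * (1024 / (23 / 25 : ℝ) ^ 3) * (∑ x ∈ SR.filter (fun p => dist p c₀ ≤ b), ‖f x‖ ^ 2) + Θ₀ / 2)) +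
          120 ^ 5 * NN[f, b]) / (b - a) ^ 5) +
      2 * (2 / κ * ((∑ x ∈ SR.filter (fun p => dist p c₀ ≤ b), ‖φ x‖ * ‖f x‖) + Λ * Θ₁ / 2 + 19 * 8192 * b ^ 3 * 𝐉[f, a₀])) := by
  have hb : 0 ≤ b := by linarith
  have hba : 0 ≤ b - a := by linarith
  -- signs of the constants
  have hM0 : 0 ≤ 𝐌[f, 2 * b] := mass_nonneg f _
  have hJ0 : 0 ≤ 𝐉[f, a₀] := farMass_nonneg f a₀ ha₀
  have hE0 : 0 ≤ ∑ x ∈ SR.filter (fun p => dist p c₀ ≤ b), ‖f x‖ ^ 2 := Finset.sum_nonneg fun _ _ => sq_nonneg _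
  have hP0 : 0 ≤ ∑ x ∈ SR.filter (fun p => dist p c₀ ≤ b), ‖φ x‖ * ‖f x‖ :=
    Finset.sum_nonneg fun _ _ => mul_nonneg (norm_nonneg _) (norm_nonneg _)
  have h2κ : 0 ≤ 2 / κ := by positivity
  have hA₂ : 0 ≤ (2 / κ * (19 * 16 * (1024 / ((23 / 25 : ℝ) ^ 3 * (23 / 25 : ℝ) ^ 3))) +
      16 * (11 / 10 : ℝ) ^ 8 * (1024 / ((23 / 25 : ℝ) ^ 3 * (23 / 25 : ℝ) ^ 3))) * 𝐌[f, 2 * b] := by positivity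
  have hA₅ : 0 ≤ 2 / κ * (38 * 4 ^ 5 * (1024 / (23 / 25 : ℝ) ^ 3) * 𝐌[f, 2 * b] +
      Λ * 20 ^ 5 * ((7 / 2) * (1024 / (23 / 25 : ℝ) ^ 3) * (∑ x ∈ SR.filter (fun p => dist p c₀ ≤ b), ‖f x‖ ^ 2) + Θ₀ / 2)) := by
    positivity
  have hB₀ : 0 ≤ 2 / κ * ((∑ x ∈ SR.filter (fun p => dist p c₀ ≤ b), ‖φ x‖ * ‖f x‖) + Λ * Θ₁ / 2 + 19 * 8192 * b ^ 3 * 𝐉[f, a₀]) := by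
    positivity
  have hZb : 0 ≤ NN[f, b] := NN_nonneg hA hI f b
  -- the absorption factor
  have hθ : 2 * (4000000 * Λ) ^ 2 / κ ^ 2 ≤ 1 / 64 := by
    have h1 : 0 ≤ 4000000 * Λ := by positivity
    have h2 : (4000000 * Λ) ^ 2 ≤ (κ / 12) ^ 2 := pow_le_pow_left₀ h1 hΛκ 2
    rw [div_le_div_iff₀ (by positivity) (by norm_num)]
    nlinarith [h2, sq_nonneg κ]
  -- Giaquinta
  have hZM : ∀ ρ : ℝ, a ≤ ρ → ρ ≤ b → NN[f, ρ] ≤ NN[f, b] := fun ρ _ hρb => NN_mono hA hI f hρb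
  have key := giaquinta_iteration_pow 5 (Z := fun ρ : ℝ => NN[f, ρ]) (a := a) (b := b)
    (A := (2 / κ * (19 * 16 * (1024 / ((23 / 25 : ℝ) ^ 3 * (23 / 25 : ℝ) ^ 3))) +
            16 * (11 / 10 : ℝ) ^ 8 * (1024 / ((23 / 25 : ℝ) ^ 3 * (23 / 25 : ℝ) ^ 3))) * 𝐌[f, 2 * b] * (b - a) ^ 3 +
          2 / κ * (38 * 4 ^ 5 * (1024 / (23 / 25 : ℝ) ^ 3) * 𝐌[f, 2 * b] +
            Λ * 20 ^ 5 * ((7 / 2) * (1024 / (23 / 25 : ℝ) ^ 3) * (∑ x ∈ SR.filter (fun p => dist p c₀ ≤ b), ‖f x‖ ^ 2) + Θ₀ / 2)) +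
          120 ^ 5 * NN[f, b])
    (B := 2 / κ * ((∑ x ∈ SR.filter (fun p => dist p c₀ ≤ b), ‖φ x‖ * ‖f x‖) + Λ * Θ₁ / 2 + 19 * 8192 * b ^ 3 * 𝐉[f, a₀]))
    (M := NN[f, b]) (by positivity) hB₀ hZM ?_ le_rfl hab le_rfl
  · exact key
  -- the step hypothesis
  intro s t' has hst htb
  have hts0 : 0 < t' - s := by linarith
  have hZt : 0 ≤ NN[f, t'] := NN_nonneg hA hI f t'
  rcases le_or_gt 120 (t' - s) with hgap | hgap
  · have hstep := caccioppoli_step hA hI hκ0 hκ hf hfB ha₀ hb SR hSRS hSRball φ Φ hrow hanti hΛ hΘ₀ hΘ₁ hΦ hvt hΘ2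
      (ha₀a.trans has) hgap htb
    exact iter_scalar_large hstep hθ hZt hZb hA₂ hgap (by linarith)
  · exact iter_scalar_small (hZM s has (by linarith)) hZt hZb hA₂ hA₅ hB₀ hba hts0 hgap

end

end Summit.AtomisticToContinuum.Crystallization.Theorems.ExcessDecayLiouville

end
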